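import Literature.Computability.MetaComplexity.RefutationCNF
import HarnessLib

/-!
# Pudlák's refutation of `RREF(F,s)`: the clauses of the refutation

The data of the explicit Resolution refutation of `RREF(F,s)` from a satisfying assignment `α` of
`F` [Atserias–Müller 2020, proof of Lemma 11] (after [Pudlák 2003]), as set-clauses over the
variables `RefVar` of `RefutationCNF.lean`, for a CNF with `n` variables, `m` clauses and `s`
lines (0-based line indices `u < s`, last line `t`, `t + 1 = s`; `α i` is the value of the
variable `X_{i+1}`):

* `trueCl α n u` — the clause `True(u) = ¬P[u] ∨ D[u,1,α(X_1)] ∨ ⋯ ∨ D[u,n,α(X_n)]` ("the active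
  line `u` contains a literal made true by `α`"), derived for `u = 0, 1, …` in order;
* `axCl` — the auxiliary clauses `A₀(j,u) = ¬I[u,j] ∨ True(u)`;
* `iCl … u k` — the chain cutting (A2) with the `A₀(j,u)`, `j < k` (`k = 0, …, m`);
* `w1Cl`, `w2Cl … k`, `w3Cl` — for a pivot index `i` and an earlier line `v < u`, the chain of the
  paper deriving `¬P[u] ∨ ¬S[u,v] ∨ ¬V[u,i] ∨ ⋁_{i' ≠ i} D[u,i',α(X_{i'})]` (their display (13)) from
  (A15)/(A16), (A20), `True(v)`, (A17)/(A18) and (A22)/(A23); here `S = side (α i)` is the premise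
  pointer `L` if `α(X_i) = 1` and `R` if `α(X_i) = 0`;
* `sCl … k`, `vcCl` — the chain cutting (A3)/(A4) with these and with (A13)/(A14), then (A11)/(A12),
  giving (a subclause of) `A₁(i,u)` cut down to `¬V[u,i] ∨ ¬I[u,0] ∨ True(u)`;
* `vCl … k`, `finCl` — the chain cutting (A1) with these for all `i`, then (A9), giving
  `¬I[u,0] ∨ True(u)`, which with `iCl … u m = I[u,0] ∨ True(u)` yields `True(u)`;
* `eCl t k` — the final chain cutting `True(t)` with (A21), ending with `¬P[t]`, refuted by (A24).

The lists `wChunk`, `iBlock`, `lineBlock`, `lastBlock`, `refutation` arrange these clauses in the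
order in which they are derived. That this list is a correct derivation (a `StepList`, every clause
a weakening of an axiom or of a resolvent of two earlier clauses) and the resulting length bound
`O((snm)²)` are proved in `RefutationCNFUpper.lean`. Our system has an explicit weakening rule, so
every clause below is only required to CONTAIN the corresponding resolvent; this is why the chains
carry `True(u)` along instead of its growing subclauses.

## References

* A. Atserias, M. Müller, *Automating Resolution is NP-hard*, J. ACM 67(5) (2020), Art. 31;
  arXiv:1904.02991, §5, proof of Lemma 11.
* P. Pudlák, *On reducibility and symmetry of disjoint NP pairs*, TCS 295 (2003), §4.
-/

namespace Literature.Computability.MetaComplexity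

open _root_.Computability Complexity

namespace RefCNF

namespace Pudlak

/-- The premise pointer variable on the side of the pivot literal falsified by the assignment:
`side true u o = L[u,o]` (case `α(X_i) = 1`: the left premise contains `¬X_i`, false under `α`),
and `side false u o = R[u,o]` (case `α(X_i) = 0`).
[cite: AtseriasMuller2020, proof of Lemma 11 (definition of A₁(i,u), cases α(X_i) = 1 / 0)] -/
def side : Bool → ℕ → Option ℕ → RefVar
  | true, u, o => RefVar.L u o
  | false, u, o => RefVar.R u o

/-- `side` on `true` is the left pointer. [folklore] -/
@[simp] theorem side_true (u : ℕ) (o : Option ℕ) : side true u o = RefVar.L u o := rfl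

/-- `side` on `false` is the right pointer. [folklore] -/
@[simp] theorem side_false (u : ℕ) (o : Option ℕ) : side false u o = RefVar.R u o := rfl

variable (α : ℕ → Bool) (n : ℕ)

/-- `True(u) := ¬P[u] ∨ D[u,1,α(X_1)] ∨ ⋯ ∨ D[u,n,α(X_n)]`: the active line `u` contains a literal
satisfied by `α`. [cite: AtseriasMuller2020, proof of Lemma 11 (the clauses True(u))] -/
def trueCl (u : ℕ) : Finset (Literal RefVar) :=
  insert (RefVar.P u, false) ((Finset.range n).image fun i => (RefVar.D u i (α i), true))

/-- `A₀(j,u) := ¬I[u,j] ∨ True(u)`, a weakening of the clause (A19) for a literal of `C_j`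
satisfied by `α`. [cite: AtseriasMuller2020, proof of Lemma 11 (the clauses A₀(j,u))] -/
def axCl (u j : ℕ) : Finset (Literal RefVar) :=
  insert (RefVar.I u (some j), false) (trueCl α n u)

/-- The `k`-th clause of the chain "cut (A2) with `A₀(j,u)` for all `j`":
`I[u,0] ∨ I[u,k+1] ∨ ⋯ ∨ I[u,m] ∨ True(u)` (`k = 0, …, m`; at `k = m` it is `I[u,0] ∨ True(u)`).
[cite: AtseriasMuller2020, proof of Lemma 11 ("Cut (A2) with this and then with A₀(j,u) for all
j ∈ [m]")] -/
def iCl (m u k : ℕ) : Finset (Literal RefVar) :=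
  insert (RefVar.I u none, true)
    (((Finset.Ico k m).image fun j => (RefVar.I u (some j), true)) ∪ trueCl α n u)

/-- First clause of the chain for pivot index `i` and earlier line `v`:
`¬P[u] ∨ ¬P[v] ∨ ¬S[u,v] ∨ ¬V[u,i] ∨ ¬D[v,i,α(X_i)]`, the resolvent of (A15)/(A16) with (A20).
[cite: AtseriasMuller2020, proof of Lemma 11 ("Cut (A15) with … of type (A20) on D[v,i,0]")] -/
def w1Cl (u i v : ℕ) : Finset (Literal RefVar) :=
  {(RefVar.P u, false), (RefVar.P v, false), (side (α i) u (some v), false),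
    (RefVar.V u (some i), false), (RefVar.D v i (α i), false)}

/-- The `k`-th clause of the transfer chain for pivot index `i` and earlier line `v`:
`¬P[v] ∨ ¬S[u,v] ∨ ¬V[u,i] ∨ ⋁_{k ≤ i' < n, i' ≠ i} D[v,i',α(X_{i'})] ∨ True(u)` (`k = 0`: the cut of
`w1Cl` with `True(v)`; step `k → k+1`: a cut with (A17)/(A18) moving `D[v,k,·]` to `D[u,k,·]`).
[cite: AtseriasMuller2020, proof of Lemma 11 ("Cut this with True(v) … Cut this with (A17) on
D[v,i',α(X_{i'})] for every i' ≠ i")] -/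
def w2Cl (u i v k : ℕ) : Finset (Literal RefVar) :=
  insert (RefVar.P v, false) (insert (side (α i) u (some v), false)
    (insert (RefVar.V u (some i), false)
      ((((Finset.Ico k n).filter fun i' => i' ≠ i).image fun i' => (RefVar.D v i' (α i'), true)) ∪
        trueCl α n u)))

/-- Last clause of the chain for pivot index `i` and earlier line `v`:
`¬S[u,v] ∨ ¬V[u,i] ∨ True(u)` (the cut of `w2Cl … n` with (A22)/(A23) on `P[v]`; display (13) of
the paper). [cite: AtseriasMuller2020, proof of Lemma 11 ("and then with (A22) on P[v]")] -/
def w3Cl (u i v : ℕ) : Finset (Literal RefVar) :=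
  insert (side (α i) u (some v), false) (insert (RefVar.V u (some i), false) (trueCl α n u))

/-- The `k`-th clause of the chain "cut (A3)/(A4) with `w3Cl … v` for `v < u` and with (A13)/(A14)
for `u ≤ v < s`": `¬V[u,i] ∨ S[u,0] ∨ S[u,k+1] ∨ ⋯ ∨ S[u,s] ∨ True(u)` (`k = 0, …, s`).
[cite: AtseriasMuller2020, proof of Lemma 11 ("Now cut (A3) with this formula for all v ∈ [u-1],
and with (A13) for all u ≤ v ≤ s")] -/
def sCl (s u i k : ℕ) : Finset (Literal RefVar) :=
  insert (RefVar.V u (some i), false) (insert (side (α i) u none, true)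
    (((Finset.Ico k s).image fun v => (side (α i) u (some v), true)) ∪ trueCl α n u))

/-- `¬V[u,i] ∨ ¬I[u,0] ∨ True(u)`: the cut of `sCl … s = ¬V[u,i] ∨ S[u,0] ∨ True(u)` (a subclause of
`A₁(i,u)`) with (A11)/(A12). [cite: AtseriasMuller2020, proof of Lemma 11 ("then with (A11) on
L[u,0]")] -/
def vcCl (u i : ℕ) : Finset (Literal RefVar) :=
  insert (RefVar.V u (some i), false) (insert (RefVar.I u none, false) (trueCl α n u))

/-- The `k`-th clause of the chain "cut (A1) with `vcCl … i` for all `i`":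
`¬I[u,0] ∨ V[u,0] ∨ V[u,k+1] ∨ ⋯ ∨ V[u,n] ∨ True(u)` (`k = 0, …, n`).
[cite: AtseriasMuller2020, proof of Lemma 11 ("cut (A1) with A₁(i,u) for all i ∈ [n]")] -/
def vCl (u k : ℕ) : Finset (Literal RefVar) :=
  insert (RefVar.I u none, false) (insert (RefVar.V u none, true)
    (((Finset.Ico k n).image fun i => (RefVar.V u (some i), true)) ∪ trueCl α n u))

/-- `¬I[u,0] ∨ True(u)`: the cut of `vCl … n` with (A9) on `V[u,0]`.
[cite: AtseriasMuller2020, proof of Lemma 11 ("Cut with (A9) on V[u,0] … to get ¬I[u,0] ∨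
True(u)")] -/
def finCl (u : ℕ) : Finset (Literal RefVar) :=
  insert (RefVar.I u none, false) (trueCl α n u)

/-- The `k`-th clause of the final chain "`n` cuts of `True(t)` with (A21)":
`¬P[t] ∨ D[t,k+1,α(X_{k+1})] ∨ ⋯ ∨ D[t,n,α(X_n)]` (`k = 0`: `True(t)`; `k = n`: `¬P[t]`).
[cite: AtseriasMuller2020, proof of Lemma 11 ("Then n many cuts with (A21) and one cut with
(A24) yield the empty clause")] -/
def eCl (t k : ℕ) : Finset (Literal RefVar) :=
  insert (RefVar.P t, false) ((Finset.Ico k n).image fun i => (RefVar.D t i (α i), true))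

/-! ### The order of derivation -/

/-- The chain for pivot index `i` and earlier line `v`: `w1Cl`, `w2Cl … 0, …, w2Cl … n`, `w3Cl`.
[cite: AtseriasMuller2020, proof of Lemma 11 (derivation of display (13), n+2 cuts)] -/
def wChunk (u i v : ℕ) : List (Finset (Literal RefVar)) :=
  w1Cl α u i v :: ((List.range (n + 1)).map (w2Cl α n u i v) ++ [w3Cl α n u i v])

/-- The block for pivot index `i` of line `u` (with `s` lines in total): the chains for all
`v < u`, then `sCl … 0, …, sCl … s`, then `vcCl`.
[cite: AtseriasMuller2020, proof of Lemma 11 (derivation of A₁(i,u))] -/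
def iBlock (s u i : ℕ) : List (Finset (Literal RefVar)) :=
  (List.range u).flatMap (wChunk α n u i) ++
    ((List.range (s + 1)).map (sCl α n s u i) ++ [vcCl α n u i])

/-- The block deriving `True(u)` (for `m` clauses of `F` and `s` lines): the `A₀(j,u)`, the
`iCl`-chain, the blocks for all pivot indices `i < n`, the `vCl`-chain, `finCl`, `True(u)`.
[cite: AtseriasMuller2020, proof of Lemma 11 (derivation of True(u))] -/
def lineBlock (m s u : ℕ) : List (Finset (Literal RefVar)) :=
  (List.range m).map (axCl α n u) ++ (List.range (m + 1)).map (iCl α n m u) ++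
    (List.range n).flatMap (iBlock α n s u) ++
      ((List.range (n + 1)).map (vCl α n u) ++ [finCl α n u, trueCl α n u])

/-- The final block: `eCl t 0, …, eCl t n`, then the empty clause.
[cite: AtseriasMuller2020, proof of Lemma 11 ("n many cuts with (A21) and one cut with (A24)")] -/
def lastBlock (t : ℕ) : List (Finset (Literal RefVar)) :=
  (List.range (n + 1)).map (eCl α n t) ++ [∅]

/-- Pudlák's refutation of `RREF(F, t+1)` as a list of set-clauses: the blocks of the lines
`0, …, t` in order, then the final block. [cite: AtseriasMuller2020, proof of Lemma 11] -/
def refutation (m t : ℕ) : List (Finset (Literal RefVar)) :=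
  (List.range (t + 1)).flatMap (lineBlock α n m (t + 1)) ++ lastBlock α n t

/-! ### Elementary facts -/

/-- `¬P[u] ∈ True(u)`. [folklore] -/
theorem negP_mem_trueCl (u : ℕ) : (RefVar.P u, false) ∈ trueCl α n u :=
  Finset.mem_insert_self _ _

/-- `D[u,i,α(X_i)] ∈ True(u)` for `i < n`. [folklore] -/
theorem posD_mem_trueCl {u i : ℕ} (hi : i < n) : (RefVar.D u i (α i), true) ∈ trueCl α n u :=
  Finset.mem_insert_of_mem (Finset.mem_image.2 ⟨i, Finset.mem_range.2 hi, rfl⟩)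

/-- Membership in `True(u)`. [folklore] -/
theorem mem_trueCl {u : ℕ} {l : Literal RefVar} :
    l ∈ trueCl α n u ↔ l = (RefVar.P u, false) ∨ ∃ i < n, (RefVar.D u i (α i), true) = l := by
  simp [trueCl]

/-- `True(u)` is the last clause of the block of line `u`. [folklore] -/
theorem trueCl_mem_lineBlock (m s u : ℕ) : trueCl α n u ∈ lineBlock α n m s u := by
  simp [lineBlock]

/-- The empty clause is the last clause of the refutation. [folklore] -/
theorem empty_mem_refutation (m t : ℕ) : (∅ : Finset (Literal RefVar)) ∈ refutation α n m t := by
  simp [refutation, lastBlock]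

/-- Length of a chain `wChunk`: `n + 3` clauses. [folklore] -/
@[simp] theorem length_wChunk (u i v : ℕ) : (wChunk α n u i v).length = n + 3 := by
  simp [wChunk]

/-- Length of a block `iBlock`: `u (n+3) + s + 2` clauses. [folklore] -/
@[simp] theorem length_iBlock (s u i : ℕ) : (iBlock α n s u i).length = u * (n + 3) + (s + 2) := by
  simp [iBlock, List.length_flatMap, List.sum_replicate]

/-- Length of the block of a line: `2m + n (u (n+3) + s + 2) + n + 4` clauses. [folklore] -/
@[simp] theorem length_lineBlock (m s u : ℕ) :
    (lineBlock α n m s u).length = 2 * m + n * (u * (n + 3) + (s + 2)) + (n + 4) := by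
  simp [lineBlock, List.length_flatMap, List.sum_replicate]
  ring

/-- Length of the final block: `n + 2` clauses. [folklore] -/
@[simp] theorem length_lastBlock (t : ℕ) : (lastBlock α n t).length = n + 2 := by
  simp [lastBlock]

end Pudlak

end RefCNF

end Literature.Computability.MetaComplexity
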